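import Literature.Probability.RandomPlanarGeometry.SAWPulledLargeForceExpansion
import HarnessLib

/-!
# The pulled self-avoiding walk on `ℤ²` at large force: the expansion of `e^{λ_B(y)}` in powers of `1/y` CONVERGES

Topic `Literature/Probability/RandomPlanarGeometry` (uses `SAWPulledLargeForceExpansion.lean`: the generic cost-series engine
`CostSeries.P / Pz / A / ev / L` (its private elementary lemmas are re-proved here as primed local copies), the integer polynomials
`A_K`, `E_K = largeForcePoly K`, THE coefficients `c_k = largeForceCoeff k` with stability `largeForcePoly_coeff`, the pulled-walk data
`sum_costCoeff_le`, `P_costCoeff_zero`, `hasSum_costPoly_inv`, and the windows `half_le_largeForceU`, `one_sub_largeForceU_le`,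
`exp_pulledBridgeFreeEnergy_eq_div`).

Printed status: the FIRST order `λ(y) = log y + O(1)` (Janse van Rensburg–Whittington 2013, §3.2 Theorem 8); Beaton 2015 Lemma 2 is the
input. `SAWPulledLargeForceExpansion.lean` proves that the expansion exists to all orders with integer coefficients; THIS file proves that the
series actually CONVERGES to `e^{λ_B(y)}` for all large `y` — real-analyticity of the pulled free energy in `1/y` at `y = ∞` in the concrete
sense of a convergent power series. We know of no printed source.

## The argument (all elementary; no analytic-function theory)

(1) MAJORANTS. The plus-recursion `Â_0 = 1`, `Â_{K+1} = 1 + Σ_{c=1}^{K+1} X^c P_c(Â_K)` in `ℕ[X]` dominates `A_K` coefficientwise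
(`|[X^k]A_K| ≤ [X^k]Â_K`). (2) SUPERSOLUTION. With `Σ_n N_{c,n} ≤ Bρ^c` and `T₀ = 1/(16ρ(B+1))`: `Â_K(T₀) ≤ 2` for every `K` (induction:
`1 + Σ_c T₀^c Bρ^c 2^{2c+1} ≤ 2`), hence ★ `|[X^k]A_K| ≤ 2·T₀^{−k}` uniformly in `K` (`abs_coeff_A_le`). (3) STABILITY. `X^{K+1} ∣ A_{K+1} − A_K`,
so `[X^k]A_K = a_k := [X^k]A_k` for `k ≤ K` (`coeff_A_eq_a`). (4) UNIFORM CONTRACTION. For `0 < t ≤ t* = min t₀ (1/(400ρ(B+1)))` the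
error `e_K = u(t) − A_K(t)` satisfies `|e_{K+1}| ≤ θ|e_K| + 2B(ρt)^{K+2}` with `θ = Σ_{c≥1} t^c L_c ≤ 24Bρt ≤ 1/4` (Lipschitz constants
`L_c ≤ (2c+1)4^c Bρ^c`), whence `|u(t) − A_K(t)| ≤ 2^{−K}` (`abs_sub_ev_A_le_half_pow`). (5) The high part of `A_K` is geometrically small
(`|A_K(t) − Σ_{k≤K} a_k t^k| ≤ 4·2^{−K−1}`), so ★★ `Σ_k a_k t^k = u(t)` (`hasSum_a`). (6) The same for the inverse polynomials
`E_K = Σ_{j≤K}(1 − A_K)^j` (majorant `Ê_K = Σ_j (1 + Â_K)^j`, `Ê_K(T₀) ≤ 3^{K+1}`, `1/A_K − E_K = (1 − A_K)^{K+1}/A_K`) and the stable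
coefficients `c_k` give ★★★ `Σ_k c_k t^k = 1/u(1/t)` and, with `e^{λ_B(y)} = y/u(y)`, the headline.

## Contents (namespace `Literature.Probability.RandomPlanarGeometry.SAW.Zd`; all PROVED, standard axioms; no data, no certificates)

* generic (`CostSeries`, data `N`): defs `Pn`, `Ahat`, `evN`, `a`, `E`, `Ehat`; ★ `abs_coeff_A_le`; `coeff_A_eq_a`; ★ `abs_sub_ev_A_le_half_pow`;
  ★★ `hasSum_a`; `abs_coeff_E_le` (+ private majorant/evaluation lemmas).
* pulled walk: def `tStar` (`= min (1/18) (1/(400ρ(B+1)))`, `B = 2c_1`, `ρ = 2c_1²`), `tStar_pos`, ★ `abs_largeForceU_sub_ev_A_le`,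
  ★★ `hasSum_largeForceU` (`Σ a_k t^k = u(1/t)`), ★★★ `hasSum_largeForceCoeff_inv` (`Σ c_k t^k = 1/u(1/t)`),
  ★★★★ **`hasSum_largeForceCoeff`**: `∀ y ≥ 1/t*, HasSum (fun k => y · (c_k · y⁻¹^k)) (e^{λ_B(y)})`, and `exp_pulledBridgeFreeEnergy_eq_tsum`
  (`∃ y₀ > 0, ∀ y ≥ y₀, e^{λ_B(y)} = Σ' k, c_k y^{1−k}`, summable);
* ANALYTIC FORM: `largeForceSeries := FormalMultilinearSeries.ofScalars ℝ (c_k)`, `largeForceSeries_radius_pos`, and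
  ★★★★ **`analyticAt_largeForceSeries_sum`**: `AnalyticAt ℝ largeForceSeries.sum 0 ∧ ∀ y ≥ 1/t*, largeForceSeries.sum (1/y) = e^{λ_B(y)}/y`
  — `e^{λ_B(y)}/y` IS the restriction of a real-analytic function of `1/y` at `0` whose Taylor coefficients are the integers `c_k`;
  ★★★★ **`analyticAt_pulledBridgeFreeEnergy_sub_log`**: `λ_B(y) = log y + h(1/y)` with `h = log ∘ largeForceSeries.sum` analytic at `0`,
  `h(0) = 0` — Janse van Rensburg–Whittington's `λ(y) = log y + O(1)` (Theorem 8) to all orders, convergent.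

Provenance: lane «pcv-sawmu», a-p3 g15 (2026-08-24).
-/

noncomputable section

open Finset Filter Topology
open scoped BigOperators

namespace Literature.Probability.RandomPlanarGeometry.SAW.Zd

namespace CostSeries

variable (N : ℕ → ℕ → ℕ)

/-! ### Local copies of the elementary lemmas of `SAWPulledLargeForceExpansion` (private there) -/

/-- `ev (Pz c) = P_c`. [folklore] -/
private theorem ev_Pz' (c : ℕ) (x : ℝ) : ev (Pz N c) x = P N c x := by
  simp [ev, Pz, P, map_sum]

/-- `A_0 = 1`. [folklore] -/
private theorem ev_A_zero' (t : ℝ) : ev (A N 0) t = 1 := by simp [ev, A]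

/-- Evaluation of the recursion `A_{K+1} = 1 − Σ_{c=1}^{K+1} X^c P_c(A_K)`. [folklore] -/
private theorem ev_A_succ' (K : ℕ) (t : ℝ) :
    ev (A N (K + 1)) t = 1 - ∑ j ∈ Finset.range (K + 1), t ^ (j + 1) * P N (j + 1) (ev (A N K) t) := by
  have h : ∀ j, ev (Polynomial.X ^ (j + 1) * (Pz N (j + 1)).comp (A N K)) t = t ^ (j + 1) * P N (j + 1) (ev (A N K) t) := by
    intro j
    rw [← ev_Pz' N (j + 1)]
    simp [ev, Polynomial.aeval_comp]
  show ev (1 - ∑ j ∈ Finset.range (K + 1), Polynomial.X ^ (j + 1) * (Pz N (j + 1)).comp (A N K)) t = _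
  simp only [ev, map_sub, map_one, map_sum]
  congr 1
  exact Finset.sum_congr rfl fun j _ => h j

/-- `P_c` is bounded by `Σ_n N_{c,n}` on `[0,1]`. [folklore] -/
private theorem P_le_sum' {c : ℕ} {x : ℝ} (h0 : 0 ≤ x) (h1 : x ≤ 1) :
    P N c x ≤ ∑ n ∈ Finset.range (2 * c + 2), (N c n : ℝ) := by
  unfold P
  refine Finset.sum_le_sum fun n _ => ?_
  have : x ^ n ≤ 1 := pow_le_one₀ h0 h1
  have hN : (0 : ℝ) ≤ N c n := by positivity
  nlinarith

/-- `P_c ≥ 0` on `[0, ∞)`. [folklore] -/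
private theorem P_nonneg' {c : ℕ} {x : ℝ} (h0 : 0 ≤ x) : 0 ≤ P N c x := by
  unfold P
  exact Finset.sum_nonneg fun n _ => by positivity

/-- `|xⁿ − x'ⁿ| ≤ n Mⁿ⁻¹ |x − x'|` for `|x|, |x'| ≤ M`. [folklore] -/
private theorem abs_pow_sub_pow_le' {x x' M : ℝ} (hx : |x| ≤ M) (hx' : |x'| ≤ M) (n : ℕ) :
    |x ^ n - x' ^ n| ≤ n * M ^ (n - 1) * |x - x'| := by
  have hM : 0 ≤ M := (abs_nonneg x).trans hx
  induction n with
  | zero => simp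
  | succ n ih =>
    have hsplit : x ^ (n + 1) - x' ^ (n + 1) = x * (x ^ n - x' ^ n) + (x - x') * x' ^ n := by ring
    rw [hsplit]
    calc |x * (x ^ n - x' ^ n) + (x - x') * x' ^ n|
        ≤ |x| * |x ^ n - x' ^ n| + |x - x'| * |x'| ^ n := by
          refine (abs_add_le _ _).trans ?_
          rw [abs_mul, abs_mul, abs_pow]
      _ ≤ M * (n * M ^ (n - 1) * |x - x'|) + |x - x'| * M ^ n := by
          gcongr
      _ = (n * (M * M ^ (n - 1)) + M ^ n) * |x - x'| := by ring
      _ ≤ ((n + 1 : ℕ) * M ^ n) * |x - x'| := by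
          refine mul_le_mul_of_nonneg_right ?_ (abs_nonneg _)
          rcases Nat.eq_zero_or_pos n with rfl | hn
          · simp
          · have : M * M ^ (n - 1) = M ^ n := by rw [← pow_succ', Nat.sub_add_cancel hn]
            rw [this]; push_cast; nlinarith [pow_nonneg hM n]
      _ = ((n + 1 : ℕ) : ℝ) * M ^ (n + 1 - 1) * |x - x'| := by simp

/-- `P_c` is `L_c`-Lipschitz on `[-2, 2]`. [folklore] -/
private theorem abs_P_sub_P_le' {c : ℕ} {x x' : ℝ} (hx : |x| ≤ 2) (hx' : |x'| ≤ 2) :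
    |P N c x - P N c x'| ≤ L N c * |x - x'| := by
  unfold P L
  rw [← Finset.sum_sub_distrib, Finset.sum_mul]
  refine (Finset.abs_sum_le_sum_abs _ _).trans (Finset.sum_le_sum fun n _ => ?_)
  rw [← mul_sub, abs_mul, Nat.abs_cast, mul_assoc]
  refine mul_le_mul_of_nonneg_left ?_ (Nat.cast_nonneg _)
  exact abs_pow_sub_pow_le' hx hx' n

/-- `L_c ≥ 0`. [folklore] -/
private theorem L_nonneg' (c : ℕ) : 0 ≤ L N c := by
  unfold L; exact Finset.sum_nonneg fun n _ => by positivity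

/-- Tail bound: if `P_c(u) ≤ B ρ^c` termwise (via `0 ≤ u ≤ 1`) and `ρ t ≤ 1/2`, then `Σ_{j} t^{j+m} P_{j+m}(u) ≤ 2 B (ρ t)^m`. [folklore] -/
private theorem tsum_tail_le' {B ρ t x : ℝ} (hB : 0 ≤ B) (hρ : 0 < ρ) (ht : 0 < t) (hρt : ρ * t ≤ 1 / 2)
    (hN : ∀ c, (∑ n ∈ Finset.range (2 * c + 2), (N c n : ℝ)) ≤ B * ρ ^ c) (hx0 : 0 ≤ x) (hx1 : x ≤ 1)
    (hs : Summable fun c => t ^ c * P N c x) (m : ℕ) :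
    ∑' j, t ^ (j + m) * P N (j + m) x ≤ 2 * B * (ρ * t) ^ m := by
  have hr0 : 0 ≤ ρ * t := by positivity
  have hr1 : ρ * t < 1 := by linarith
  have hsm : Summable fun j => t ^ (j + m) * P N (j + m) x :=
    (summable_nat_add_iff (f := fun c => t ^ c * P N c x) m).2 hs
  have hgeo : Summable fun j : ℕ => B * (ρ * t) ^ m * (ρ * t) ^ j :=
    (summable_geometric_of_lt_one hr0 hr1).mul_left _
  have hle : ∀ j, t ^ (j + m) * P N (j + m) x ≤ B * (ρ * t) ^ m * (ρ * t) ^ j := by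
    intro j
    have h1 : P N (j + m) x ≤ B * ρ ^ (j + m) := (P_le_sum' N hx0 hx1).trans (hN _)
    have h2 : 0 ≤ t ^ (j + m) := by positivity
    calc t ^ (j + m) * P N (j + m) x ≤ t ^ (j + m) * (B * ρ ^ (j + m)) := mul_le_mul_of_nonneg_left h1 h2
      _ = B * (ρ * t) ^ m * (ρ * t) ^ j := by rw [mul_pow, mul_pow]; ring
  calc ∑' j, t ^ (j + m) * P N (j + m) x ≤ ∑' j, B * (ρ * t) ^ m * (ρ * t) ^ j := hsm.tsum_le_tsum hle hgeo
    _ = B * (ρ * t) ^ m * (1 - ρ * t)⁻¹ := by rw [tsum_mul_left, tsum_geometric_of_lt_one hr0 hr1]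
    _ ≤ B * (ρ * t) ^ m * 2 := by
        refine mul_le_mul_of_nonneg_left ?_ (by positivity)
        rw [inv_le_comm₀ (by linarith) (by norm_num)]; linarith
    _ = 2 * B * (ρ * t) ^ m := by ring

/-! ### Majorants: the plus-recursion `Â_{K+1} = 1 + Σ_{c=1}^{K+1} X^c P_c(Â_K)` dominates `A_K` coefficientwise -/

/-- `P_c` as a polynomial with natural coefficients. [folklore] -/
def Pn (c : ℕ) : Polynomial ℕ := ∑ n ∈ Finset.range (2 * c + 2), Polynomial.C (N c n) * Polynomial.X ^ n

/-- The majorant approximants `Â_0 = 1`, `Â_{K+1} = 1 + Σ_{j<K+1} X^{j+1} P_{j+1}(Â_K)` (natural coefficients). [folklore] -/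
def Ahat : ℕ → Polynomial ℕ
  | 0 => 1
  | K + 1 => 1 + ∑ j ∈ Finset.range (K + 1), Polynomial.X ^ (j + 1) * (Pn N (j + 1)).comp (Ahat K)

/-- Coefficientwise domination of an integer polynomial by a natural polynomial. [folklore] -/
private def Dom (p : Polynomial ℤ) (q : Polynomial ℕ) : Prop := ∀ k, |p.coeff k| ≤ (q.coeff k : ℤ)

/-- Domination is preserved by sums. [folklore] -/
private theorem Dom.add {p p' : Polynomial ℤ} {q q' : Polynomial ℕ} (h : Dom p q) (h' : Dom p' q') : Dom (p + p') (q + q') := by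
  intro k
  rw [Polynomial.coeff_add, Polynomial.coeff_add, Nat.cast_add]
  exact (abs_add_le _ _).trans (add_le_add (h k) (h' k))

/-- Domination is preserved by differences. [folklore] -/
private theorem Dom.sub {p p' : Polynomial ℤ} {q q' : Polynomial ℕ} (h : Dom p q) (h' : Dom p' q') : Dom (p - p') (q + q') := by
  intro k
  rw [Polynomial.coeff_sub, Polynomial.coeff_add, Nat.cast_add]
  exact (abs_sub _ _).trans (add_le_add (h k) (h' k))

/-- Domination is preserved by products. [folklore] -/
private theorem Dom.mul {p p' : Polynomial ℤ} {q q' : Polynomial ℕ} (h : Dom p q) (h' : Dom p' q') : Dom (p * p') (q * q') := by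
  intro k
  rw [Polynomial.coeff_mul, Polynomial.coeff_mul, Nat.cast_sum]
  refine (Finset.abs_sum_le_sum_abs _ _).trans (Finset.sum_le_sum fun x _ => ?_)
  rw [abs_mul, Nat.cast_mul]
  exact mul_le_mul (h _) (h' _) (abs_nonneg _) ((abs_nonneg _).trans (h _))

/-- `1` dominates `1`. [folklore] -/
private theorem Dom.one : Dom 1 1 := by
  intro k; simp [Polynomial.coeff_one]; split_ifs <;> simp

/-- `X^n` dominates `X^n`. [folklore] -/
private theorem Dom.X_pow (n : ℕ) : Dom (Polynomial.X ^ n) (Polynomial.X ^ n) := by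
  intro k; simp [Polynomial.coeff_X_pow]; split_ifs <;> simp

/-- Domination is preserved by powers. [folklore] -/
private theorem Dom.pow {p : Polynomial ℤ} {q : Polynomial ℕ} (h : Dom p q) : ∀ n : ℕ, Dom (p ^ n) (q ^ n)
  | 0 => by simpa using Dom.one
  | n + 1 => by rw [pow_succ, pow_succ]; exact (Dom.pow h n).mul h

/-- Domination is preserved by finite sums. [folklore] -/
private theorem Dom.sum {ι : Type*} (s : Finset ι) {p : ι → Polynomial ℤ} {q : ι → Polynomial ℕ} (h : ∀ i ∈ s, Dom (p i) (q i)) :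
    Dom (∑ i ∈ s, p i) (∑ i ∈ s, q i) := by
  classical
  induction s using Finset.induction_on with
  | empty => intro k; simp
  | insert a s ha ih =>
    rw [Finset.sum_insert ha, Finset.sum_insert ha]
    exact (h a (Finset.mem_insert_self a s)).add (ih fun i hi => h i (Finset.mem_insert_of_mem hi))

/-- Domination is preserved by natural scalars. [folklore] -/
private theorem Dom.natCast_mul {p : Polynomial ℤ} {q : Polynomial ℕ} (h : Dom p q) (m : ℕ) :
    Dom (Polynomial.C (m : ℤ) * p) (Polynomial.C m * q) := by
  intro k
  rw [Polynomial.coeff_C_mul, Polynomial.coeff_C_mul, abs_mul, Nat.cast_mul, Nat.abs_cast]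
  exact mul_le_mul_of_nonneg_left (h k) (Nat.cast_nonneg m)

/-- `P_c(A)` is dominated by `P_c(Â)`. [folklore] -/
private theorem Dom.Pcomp {p : Polynomial ℤ} {q : Polynomial ℕ} (h : Dom p q) (c : ℕ) : Dom ((Pz N c).comp p) ((Pn N c).comp q) := by
  unfold Pz Pn
  rw [Polynomial.sum_comp, Polynomial.sum_comp]
  refine Dom.sum _ fun n _ => ?_
  rw [Polynomial.mul_comp, Polynomial.C_comp, Polynomial.X_pow_comp, Polynomial.mul_comp, Polynomial.C_comp, Polynomial.X_pow_comp]
  exact (h.pow n).natCast_mul (N c n)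

/-- `A_K` is dominated by `Â_K`. [folklore] -/
private theorem dom_A_Ahat : ∀ K, Dom (A N K) (Ahat N K)
  | 0 => by simpa [A, Ahat] using Dom.one
  | K + 1 => by
    show Dom (1 - ∑ j ∈ Finset.range (K + 1), Polynomial.X ^ (j + 1) * (Pz N (j + 1)).comp (A N K))
      (1 + ∑ j ∈ Finset.range (K + 1), Polynomial.X ^ (j + 1) * (Pn N (j + 1)).comp (Ahat N K))
    exact Dom.one.sub (Dom.sum _ fun j _ => (Dom.X_pow (j + 1)).mul ((dom_A_Ahat K).Pcomp N (j + 1)))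

/-! ### The supersolution bound `Â_K(T₀) ≤ 2` and geometric coefficient bounds -/

/-- Real evaluation of a natural polynomial. [folklore] -/
def evN (q : Polynomial ℕ) (t : ℝ) : ℝ := (q.map (Nat.castRingHom ℝ)).eval t

/-- Evaluation of `P_c(q)`. [folklore] -/
private theorem evN_Pn (c : ℕ) (x : ℝ) (q : Polynomial ℕ) : evN ((Pn N c).comp q) x = P N c (evN q x) := by
  simp [evN, Pn, P, Polynomial.map_sum, Polynomial.eval_finsetSum]

/-- Evaluation of the majorant recursion. [folklore] -/
private theorem evN_Ahat_succ (K : ℕ) (t : ℝ) :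
    evN (Ahat N (K + 1)) t = 1 + ∑ j ∈ Finset.range (K + 1), t ^ (j + 1) * P N (j + 1) (evN (Ahat N K) t) := by
  have h : ∀ j, evN (Polynomial.X ^ (j + 1) * (Pn N (j + 1)).comp (Ahat N K)) t = t ^ (j + 1) * P N (j + 1) (evN (Ahat N K) t) := by
    intro j
    rw [← evN_Pn N (j + 1) t (Ahat N K)]
    simp [evN]
  show evN (1 + ∑ j ∈ Finset.range (K + 1), Polynomial.X ^ (j + 1) * (Pn N (j + 1)).comp (Ahat N K)) t = _
  simp only [evN, Polynomial.map_add, Polynomial.map_one, Polynomial.eval_add, Polynomial.eval_one, Polynomial.map_sum,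
    Polynomial.eval_finsetSum]
  congr 1
  exact Finset.sum_congr rfl fun j _ => h j

/-- Natural polynomials are non-negative on `[0, ∞)`. [folklore] -/
private theorem evN_nonneg (q : Polynomial ℕ) {t : ℝ} (ht : 0 ≤ t) : 0 ≤ evN q t := by
  rw [evN, Polynomial.eval_eq_sum_range]
  exact Finset.sum_nonneg fun i _ => by rw [Polynomial.coeff_map]; simp only [eq_natCast]; positivity

/-- `P_c(x) ≤ (Σ_n N_{c,n}) · max(1,x)^{2c+1}` for `x ≥ 0`. [folklore] -/
private theorem P_le_sum_mul_pow {c : ℕ} {x : ℝ} (h0 : 0 ≤ x) :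
    P N c x ≤ (∑ n ∈ Finset.range (2 * c + 2), (N c n : ℝ)) * max 1 x ^ (2 * c + 1) := by
  unfold P
  rw [Finset.sum_mul]
  refine Finset.sum_le_sum fun n hn => ?_
  have hn' : n ≤ 2 * c + 1 := by have := Finset.mem_range.1 hn; omega
  have hm1 : 1 ≤ max 1 x := le_max_left _ _
  have hx : x ^ n ≤ max 1 x ^ (2 * c + 1) :=
    (pow_le_pow_left₀ h0 (le_max_right _ _) n).trans (pow_le_pow_right₀ hm1 hn')
  exact mul_le_mul_of_nonneg_left hx (Nat.cast_nonneg _)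

/-- `Σ_{j<n} q^j ≤ 2` for `0 ≤ q ≤ 1/2`. [folklore] -/
private theorem geom_sum_le_two {q : ℝ} (hq0 : 0 ≤ q) (hq : q ≤ 1 / 2) : ∀ n : ℕ, ∑ j ∈ Finset.range n, q ^ j ≤ 2
  | 0 => by simp
  | n + 1 => by
    rw [Finset.sum_range_succ']
    simp only [pow_succ, pow_zero]
    have ih := geom_sum_le_two hq0 hq n
    have : ∑ j ∈ Finset.range n, q ^ j * q = (∑ j ∈ Finset.range n, q ^ j) * q := by rw [Finset.sum_mul]
    rw [this]
    nlinarith [Finset.sum_nonneg (fun j (_ : j ∈ Finset.range n) => pow_nonneg hq0 j)]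

/-- **Supersolution**: with `Σ_n N_{c,n} ≤ B ρ^c` and `T₀ = 1/(16 ρ (B + 1))`, `Â_K(T₀) ≤ 2` for every `K`. [folklore] -/
private theorem evN_Ahat_le_two {B ρ : ℝ} (hB : 0 ≤ B) (hρ : 0 < ρ)
    (hN : ∀ c, (∑ n ∈ Finset.range (2 * c + 2), (N c n : ℝ)) ≤ B * ρ ^ c) :
    ∀ K, evN (Ahat N K) (1 / (16 * ρ * (B + 1))) ≤ 2 := by
  set T : ℝ := 1 / (16 * ρ * (B + 1)) with hT
  have hT0 : 0 < T := by rw [hT]; positivity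
  have h4 : 4 * ρ * T = 1 / (4 * (B + 1)) := by rw [hT]; field_simp; ring
  have hq : 4 * ρ * T ≤ 1 / 2 := by
    rw [h4, div_le_div_iff₀ (by positivity) (by norm_num)]; nlinarith
  have hr0 : 0 ≤ 4 * ρ * T := by positivity
  intro K
  induction K with
  | zero => simp [evN, Ahat]
  | succ K ih =>
    rw [evN_Ahat_succ]
    have h0 : 0 ≤ evN (Ahat N K) T := evN_nonneg (Ahat N K) hT0.le
    have hmax : max 1 (evN (Ahat N K) T) ≤ 2 := max_le (by norm_num) ih
    have hterm : ∀ j ∈ Finset.range (K + 1),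
        T ^ (j + 1) * P N (j + 1) (evN (Ahat N K) T) ≤ 2 * B * ((4 * ρ * T) ^ j * (4 * ρ * T)) := by
      intro j _
      have h1 := P_le_sum_mul_pow N (c := j + 1) h0
      have h2 : max 1 (evN (Ahat N K) T) ^ (2 * (j + 1) + 1) ≤ 2 ^ (2 * (j + 1) + 1) :=
        pow_le_pow_left₀ (by positivity) hmax _
      have h3 := hN (j + 1)
      have h22 : (2 : ℝ) ^ (2 * (j + 1) + 1) = 8 * 4 ^ j := by
        rw [pow_succ, pow_mul, pow_succ]; norm_num; ring
      calc T ^ (j + 1) * P N (j + 1) (evN (Ahat N K) T)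
          ≤ T ^ (j + 1) * ((B * ρ ^ (j + 1)) * 2 ^ (2 * (j + 1) + 1)) := by
            refine mul_le_mul_of_nonneg_left ?_ (by positivity)
            exact h1.trans (mul_le_mul h3 h2 (by positivity) (by positivity))
        _ = 2 * B * ((4 * ρ * T) ^ j * (4 * ρ * T)) := by
            rw [h22, mul_pow, mul_pow, pow_succ, pow_succ]; ring
    have hgeom : ∑ j ∈ Finset.range (K + 1), 2 * B * ((4 * ρ * T) ^ j * (4 * ρ * T)) ≤ 2 * B * (2 * (4 * ρ * T)) := by
      rw [← Finset.mul_sum, ← Finset.sum_mul]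
      refine mul_le_mul_of_nonneg_left (mul_le_mul_of_nonneg_right (geom_sum_le_two hr0 hq (K + 1)) hr0) (by positivity)
    have hfin : 2 * B * (2 * (4 * ρ * T)) ≤ 1 := by
      rw [h4]
      rw [show 2 * B * (2 * (1 / (4 * (B + 1)))) = B / (B + 1) by field_simp; ring]
      rw [div_le_one (by positivity)]; linarith
    linarith [Finset.sum_le_sum hterm]

/-- Coefficients of a natural polynomial are bounded by its value: `q_k T^k ≤ q(T)` for `T ≥ 0`. [folklore] -/
private theorem coeff_mul_pow_le_evN (q : Polynomial ℕ) {T : ℝ} (hT : 0 ≤ T) (k : ℕ) :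
    (q.coeff k : ℝ) * T ^ k ≤ evN q T := by
  rw [evN, Polynomial.eval_eq_sum_range, Polynomial.natDegree_map_eq_of_injective Nat.cast_injective]
  have hterm : ∀ i, (q.map (Nat.castRingHom ℝ)).coeff i * T ^ i = (q.coeff i : ℝ) * T ^ i := by
    intro i; rw [Polynomial.coeff_map]; simp
  simp only [hterm]
  by_cases hk : k ≤ q.natDegree
  · have hmem : k ∈ Finset.range (q.natDegree + 1) := Finset.mem_range.2 (Nat.lt_succ_of_le hk)
    exact Finset.single_le_sum (f := fun i => (q.coeff i : ℝ) * T ^ i) (fun i _ => by positivity) hmem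
  · rw [Polynomial.coeff_eq_zero_of_natDegree_lt (not_le.1 hk)]
    simp only [Nat.cast_zero, zero_mul]
    exact Finset.sum_nonneg fun i _ => by positivity

/-- ★ **Geometric bound on the coefficients of the approximants**: `|[X^k] A_K| ≤ 2 · (16ρ(B+1))^k` for all `K, k` (majorant series +
supersolution `Â_K(T₀) ≤ 2`): the formal expansion has a positive radius of convergence. [cite: JansevanRensburgWhittington2013, §3.2 Theorem 8 (arXiv v4 p. 11)] -/
theorem abs_coeff_A_le {B ρ : ℝ} (hB : 0 ≤ B) (hρ : 0 < ρ)
    (hN : ∀ c, (∑ n ∈ Finset.range (2 * c + 2), (N c n : ℝ)) ≤ B * ρ ^ c) (K k : ℕ) :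
    |((A N K).coeff k : ℝ)| ≤ 2 * (16 * ρ * (B + 1)) ^ k := by
  set T : ℝ := 1 / (16 * ρ * (B + 1)) with hT
  have hR : 0 < 16 * ρ * (B + 1) := by positivity
  have hT0 : 0 < T := by rw [hT]; positivity
  have hdom := dom_A_Ahat N K k
  have h1 : |((A N K).coeff k : ℝ)| ≤ ((Ahat N K).coeff k : ℝ) := by exact_mod_cast hdom
  have h2 : ((Ahat N K).coeff k : ℝ) * T ^ k ≤ 2 :=
    (coeff_mul_pow_le_evN (Ahat N K) hT0.le k).trans (evN_Ahat_le_two N hB hρ hN K)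
  have hTk : T ^ k * (16 * ρ * (B + 1)) ^ k = 1 := by
    rw [← mul_pow, hT, one_div, inv_mul_cancel₀ hR.ne', one_pow]
  have h3 : ((Ahat N K).coeff k : ℝ) ≤ 2 * (16 * ρ * (B + 1)) ^ k := by
    have := mul_le_mul_of_nonneg_right h2 (pow_nonneg hR.le k)
    rwa [mul_assoc, hTk, mul_one] at this
  exact h1.trans h3

/-! ### The contraction estimate: `|u(t) − A_K(t)| ≤ 2^{−K}` for small `t` -/

/-- Bound for the Lipschitz constants: `L_c ≤ (2c+1) 4^c · B ρ^c`. [folklore] -/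
private theorem L_le {B ρ : ℝ} (hN : ∀ c, (∑ n ∈ Finset.range (2 * c + 2), (N c n : ℝ)) ≤ B * ρ ^ c) (c : ℕ) :
    L N c ≤ (2 * c + 1) * 4 ^ c * (B * ρ ^ c) := by
  unfold L
  have hterm : ∀ n ∈ Finset.range (2 * c + 2), (N c n : ℝ) * (n * 2 ^ (n - 1)) ≤ (N c n : ℝ) * ((2 * c + 1) * 4 ^ c) := by
    intro n hn
    have hn : n ≤ 2 * c + 1 := by have := Finset.mem_range.1 hn; omega
    refine mul_le_mul_of_nonneg_left ?_ (Nat.cast_nonneg _)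
    have h1 : (n : ℝ) ≤ 2 * c + 1 := by exact_mod_cast hn
    have h2 : (2 : ℝ) ^ (n - 1) ≤ 4 ^ c := by
      calc (2 : ℝ) ^ (n - 1) ≤ 2 ^ (2 * c) := pow_le_pow_right₀ (by norm_num) (by omega)
        _ = 4 ^ c := by rw [pow_mul]; norm_num
    exact mul_le_mul h1 h2 (by positivity) (by positivity)
  calc ∑ n ∈ Finset.range (2 * c + 2), (N c n : ℝ) * (n * 2 ^ (n - 1))
      ≤ ∑ n ∈ Finset.range (2 * c + 2), (N c n : ℝ) * ((2 * c + 1) * 4 ^ c) := Finset.sum_le_sum hterm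
    _ = (∑ n ∈ Finset.range (2 * c + 2), (N c n : ℝ)) * ((2 * c + 1) * 4 ^ c) := by rw [Finset.sum_mul]
    _ ≤ (B * ρ ^ c) * ((2 * c + 1) * 4 ^ c) := mul_le_mul_of_nonneg_right (hN c) (by positivity)
    _ = (2 * c + 1) * 4 ^ c * (B * ρ ^ c) := by ring

/-- `Σ_{j<n} (2j+3) q^{j+1} ≤ 6q` for `0 ≤ q ≤ 1/4` (via `2j+3 ≤ 3·2^j`). [folklore] -/
private theorem sum_odd_mul_pow_le {q : ℝ} (hq0 : 0 ≤ q) (hq : q ≤ 1 / 4) (n : ℕ) :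
    ∑ j ∈ Finset.range n, (2 * (j + 1 : ℕ) + 1 : ℝ) * q ^ (j + 1) ≤ 6 * q := by
  have hodd : ∀ j : ℕ, (2 * (j + 1 : ℕ) + 1 : ℝ) ≤ 3 * 2 ^ j := by
    intro j
    induction j with
    | zero => norm_num
    | succ i ih => push_cast at ih ⊢; rw [pow_succ]; nlinarith [pow_nonneg (show (0:ℝ) ≤ 2 by norm_num) i]
  calc ∑ j ∈ Finset.range n, (2 * (j + 1 : ℕ) + 1 : ℝ) * q ^ (j + 1)
      ≤ ∑ j ∈ Finset.range n, 3 * q * (2 * q) ^ j := by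
        refine Finset.sum_le_sum fun j _ => ?_
        calc (2 * (j + 1 : ℕ) + 1 : ℝ) * q ^ (j + 1) ≤ 3 * 2 ^ j * q ^ (j + 1) :=
              mul_le_mul_of_nonneg_right (hodd j) (by positivity)
          _ = 3 * q * (2 * q) ^ j := by rw [mul_pow, pow_succ]; ring
    _ = 3 * q * ∑ j ∈ Finset.range n, (2 * q) ^ j := by rw [Finset.mul_sum]
    _ ≤ 3 * q * 2 := mul_le_mul_of_nonneg_left (geom_sum_le_two (by positivity) (by linarith) n) (by positivity)
    _ = 6 * q := by ring

/-- ★ **Uniform contraction**: under the hypotheses of `expansion`, for `0 < t ≤ t* = min t₀ (1/(400ρ(B+1)))` and every `K`,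
`|u(t) − A_K(t)| ≤ 2^{−K}`. [cite: JansevanRensburgWhittington2013, §3.2 Theorem 8 (arXiv v4 p. 11)] -/
theorem abs_sub_ev_A_le_half_pow {B ρ t₀ : ℝ} {u : ℝ → ℝ} (hB : 0 ≤ B) (hρ : 0 < ρ)
    (hN : ∀ c, (∑ n ∈ Finset.range (2 * c + 2), (N c n : ℝ)) ≤ B * ρ ^ c) (hP0 : ∀ x, P N 0 x = x)
    (hmem : ∀ t ∈ Set.Ioc 0 t₀, u t ∈ Set.Icc (0 : ℝ) 1)
    (heq : ∀ t ∈ Set.Ioc 0 t₀, HasSum (fun c => t ^ c * P N c (u t)) 1)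
    {t : ℝ} (ht : t ∈ Set.Ioc 0 (min t₀ (1 / (400 * ρ * (B + 1))))) :
    ∀ K, |u t - ev (A N K) t| ≤ (1 / 2) ^ K := by
  have ht0 : 0 < t := ht.1
  have htt₀ : t ≤ t₀ := ht.2.trans (min_le_left _ _)
  have ht4 : t ≤ 1 / (400 * ρ * (B + 1)) := ht.2.trans (min_le_right _ _)
  have hρt : ρ * t ≤ 1 / (400 * (B + 1)) := by
    have := mul_le_mul_of_nonneg_left ht4 hρ.le
    rwa [show ρ * (1 / (400 * ρ * (B + 1))) = 1 / (400 * (B + 1)) by field_simp] at this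
  have hρt400 : ρ * t ≤ 1 / 400 :=
    hρt.trans (div_le_div_of_nonneg_left (by norm_num) (by norm_num) (by nlinarith))
  have hρt2 : ρ * t ≤ 1 / 2 := by linarith
  have hBρt : 2 * B * (ρ * t) ≤ 1 / 200 := by
    calc 2 * B * (ρ * t) ≤ 2 * B * (1 / (400 * (B + 1))) := mul_le_mul_of_nonneg_left hρt (by positivity)
      _ = B / (B + 1) / 200 := by field_simp; ring
      _ ≤ 1 / 200 := by
          refine div_le_div_of_nonneg_right ?_ (by norm_num)
          rw [div_le_one (by positivity)]; linarith
  obtain ⟨hu0, hu1⟩ := hmem t ⟨ht0, htt₀⟩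
  -- tail identity
  have htail : ∑' j, t ^ (j + 1) * P N (j + 1) (u t) = 1 - u t := by
    have h := (heq t ⟨ht0, htt₀⟩).tsum_eq
    rw [(heq t ⟨ht0, htt₀⟩).summable.tsum_eq_zero_add] at h
    simp only [pow_zero, one_mul, hP0] at h
    linarith
  have hs : Summable fun c => t ^ c * P N c (u t) := (heq t ⟨ht0, htt₀⟩).summable
  have hs1 : Summable fun j => t ^ (j + 1) * P N (j + 1) (u t) :=
    (summable_nat_add_iff (f := fun c => t ^ c * P N c (u t)) 1).2 hs
  intro K
  induction K with
  | zero =>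
    rw [ev_A_zero', abs_sub_comm, abs_of_nonneg (by linarith), ← htail, pow_zero]
    have := tsum_tail_le' N hB hρ ht0 hρt2 hN hu0 hu1 hs 1
    have h' : ∑' j, t ^ (j + 1) * P N (j + 1) (u t) ≤ 2 * B * (ρ * t) := by simpa [pow_one] using this
    linarith
  | succ K ih =>
    set a := ev (A N K) t with ha
    have hua : |u t - a| ≤ 1 := ih.trans (pow_le_one₀ (by norm_num) (by norm_num))
    have ha2 : |a| ≤ 2 := by
      have : |a| ≤ |u t| + |u t - a| := by
        calc |a| = |u t - (u t - a)| := by ring_nf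
          _ ≤ |u t| + |u t - a| := abs_sub _ _
      rw [abs_of_nonneg hu0] at this; linarith
    have hu2 : |u t| ≤ 2 := by rw [abs_of_nonneg hu0]; linarith
    have hsplit : ∑ j ∈ Finset.range (K + 1), t ^ (j + 1) * P N (j + 1) (u t)
        + ∑' j, t ^ (j + (K + 1) + 1) * P N (j + (K + 1) + 1) (u t) = ∑' j, t ^ (j + 1) * P N (j + 1) (u t) :=
      hs1.sum_add_tsum_nat_add (K + 1)
    have htailb : ∑' j, t ^ (j + (K + 1) + 1) * P N (j + (K + 1) + 1) (u t) ≤ 2 * B * (ρ * t) ^ (K + 2) := by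
      have := tsum_tail_le' N hB hρ ht0 hρt2 hN hu0 hu1 hs (K + 2)
      simpa [add_assoc] using this
    have htail0 : 0 ≤ ∑' j, t ^ (j + (K + 1) + 1) * P N (j + (K + 1) + 1) (u t) :=
      tsum_nonneg fun j => mul_nonneg (by positivity) (P_nonneg' N hu0)
    have hq0 : 0 ≤ 4 * ρ * t := by positivity
    have hq : 4 * ρ * t ≤ 1 / 4 := by linarith
    have hθ : ∑ j ∈ Finset.range (K + 1), t ^ (j + 1) * L N (j + 1) ≤ 1 / 4 := by
      calc ∑ j ∈ Finset.range (K + 1), t ^ (j + 1) * L N (j + 1)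
          ≤ ∑ j ∈ Finset.range (K + 1), B * ((2 * (j + 1 : ℕ) + 1 : ℝ) * (4 * ρ * t) ^ (j + 1)) := by
            refine Finset.sum_le_sum fun j _ => ?_
            have hL := L_le N hN (j + 1)
            calc t ^ (j + 1) * L N (j + 1) ≤ t ^ (j + 1) * ((2 * (j + 1 : ℕ) + 1) * 4 ^ (j + 1) * (B * ρ ^ (j + 1))) := by
                  refine mul_le_mul_of_nonneg_left ?_ (by positivity); exact_mod_cast hL
              _ = B * ((2 * (j + 1 : ℕ) + 1 : ℝ) * (4 * ρ * t) ^ (j + 1)) := by rw [mul_pow, mul_pow]; ring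
        _ = B * ∑ j ∈ Finset.range (K + 1), (2 * (j + 1 : ℕ) + 1 : ℝ) * (4 * ρ * t) ^ (j + 1) := by rw [Finset.mul_sum]
        _ ≤ B * (6 * (4 * ρ * t)) := mul_le_mul_of_nonneg_left (sum_odd_mul_pow_le hq0 hq (K + 1)) hB
        _ = 12 * (2 * B * (ρ * t)) := by ring
        _ ≤ 12 * (1 / 200) := by linarith
        _ ≤ 1 / 4 := by norm_num
    have hfin : |∑ j ∈ Finset.range (K + 1), t ^ (j + 1) * (P N (j + 1) a - P N (j + 1) (u t))| ≤ (1 / 4) * (1 / 2) ^ K := by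
      calc |∑ j ∈ Finset.range (K + 1), t ^ (j + 1) * (P N (j + 1) a - P N (j + 1) (u t))|
          ≤ ∑ j ∈ Finset.range (K + 1), |t ^ (j + 1) * (P N (j + 1) a - P N (j + 1) (u t))| := Finset.abs_sum_le_sum_abs _ _
        _ ≤ ∑ j ∈ Finset.range (K + 1), t ^ (j + 1) * L N (j + 1) * (1 / 2) ^ K := by
            refine Finset.sum_le_sum fun j _ => ?_
            rw [abs_mul, abs_of_nonneg (by positivity), mul_assoc]
            refine mul_le_mul_of_nonneg_left ?_ (by positivity)
            calc |P N (j + 1) a - P N (j + 1) (u t)| ≤ L N (j + 1) * |a - u t| := abs_P_sub_P_le' N ha2 hu2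
              _ ≤ L N (j + 1) * (1 / 2) ^ K := by
                  rw [abs_sub_comm]; exact mul_le_mul_of_nonneg_left ih (L_nonneg' N _)
        _ = (∑ j ∈ Finset.range (K + 1), t ^ (j + 1) * L N (j + 1)) * (1 / 2) ^ K := by rw [Finset.sum_mul]
        _ ≤ (1 / 4) * (1 / 2) ^ K := mul_le_mul_of_nonneg_right hθ (by positivity)
    have htail2 : 2 * B * (ρ * t) ^ (K + 2) ≤ (1 / 4) * (1 / 2) ^ K := by
      have h2 : (ρ * t) ^ (K + 1) ≤ (1 / 2) ^ (K + 1) := pow_le_pow_left₀ (by positivity) hρt2 _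
      calc 2 * B * (ρ * t) ^ (K + 2) = 2 * B * (ρ * t) * (ρ * t) ^ (K + 1) := by ring
        _ ≤ (1 / 200) * (1 / 2) ^ (K + 1) := mul_le_mul hBρt h2 (by positivity) (by norm_num)
        _ ≤ (1 / 4) * (1 / 2) ^ K := by rw [pow_succ]; nlinarith [pow_pos (show (0:ℝ) < 1/2 by norm_num) K]
    rw [ev_A_succ']
    have hdiff : u t - (1 - ∑ j ∈ Finset.range (K + 1), t ^ (j + 1) * P N (j + 1) a) =
        ∑ j ∈ Finset.range (K + 1), t ^ (j + 1) * (P N (j + 1) a - P N (j + 1) (u t))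
          - ∑' j, t ^ (j + (K + 1) + 1) * P N (j + (K + 1) + 1) (u t) := by
      rw [Finset.sum_congr rfl fun j _ => mul_sub (t ^ (j + 1)) (P N (j + 1) a) (P N (j + 1) (u t)),
        Finset.sum_sub_distrib]
      linarith [hsplit, htail]
    rw [hdiff]
    calc |∑ j ∈ Finset.range (K + 1), t ^ (j + 1) * (P N (j + 1) a - P N (j + 1) (u t))
          - ∑' j, t ^ (j + (K + 1) + 1) * P N (j + (K + 1) + 1) (u t)|
        ≤ |∑ j ∈ Finset.range (K + 1), t ^ (j + 1) * (P N (j + 1) a - P N (j + 1) (u t))|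
          + |∑' j, t ^ (j + (K + 1) + 1) * P N (j + (K + 1) + 1) (u t)| := abs_sub _ _
      _ ≤ (1 / 4) * (1 / 2) ^ K + (1 / 4) * (1 / 2) ^ K := by
          rw [abs_of_nonneg htail0]; exact add_le_add hfin (htailb.trans htail2)
      _ = (1 / 2) ^ (K + 1) := by rw [pow_succ]; ring

/-! ### Stability of the coefficients: `[X^k] A_K = [X^k] A_k =: a_k` for `k ≤ K` -/

/-- `p.comp q − p.comp r` is divisible by `q − r`. [folklore] -/
private theorem sub_dvd_comp_sub (p q r : Polynomial ℤ) : q - r ∣ p.comp q - p.comp r := by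
  have h := Polynomial.sub_dvd_eval_sub q r (p.map Polynomial.C)
  rwa [Polynomial.eval_map, Polynomial.eval_map] at h

/-- `X^{K+1} ∣ A_{K+1} − A_K`. [folklore] -/
private theorem X_pow_dvd_A_succ_sub : ∀ K, Polynomial.X ^ (K + 1) ∣ A N (K + 1) - A N K
  | 0 => by
    show Polynomial.X ^ (0 + 1) ∣ (1 - ∑ j ∈ Finset.range (0 + 1), Polynomial.X ^ (j + 1) * (Pz N (j + 1)).comp (A N 0)) - 1
    simp only [zero_add, Finset.range_one, Finset.sum_singleton, pow_one, sub_sub_cancel_left]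
    exact Dvd.dvd.neg_right (dvd_mul_right _ _)
  | K + 1 => by
    have ih := X_pow_dvd_A_succ_sub K
    have hstep : ∀ j, Polynomial.X ^ (K + 2) ∣
        Polynomial.X ^ (j + 1) * ((Pz N (j + 1)).comp (A N (K + 1)) - (Pz N (j + 1)).comp (A N K)) := by
      intro j
      have h1 : Polynomial.X ^ (K + 1) ∣ (Pz N (j + 1)).comp (A N (K + 1)) - (Pz N (j + 1)).comp (A N K) :=
        dvd_trans ih (sub_dvd_comp_sub _ _ _)
      have h2 : Polynomial.X ^ (j + 1) * Polynomial.X ^ (K + 1) ∣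
          Polynomial.X ^ (j + 1) * ((Pz N (j + 1)).comp (A N (K + 1)) - (Pz N (j + 1)).comp (A N K)) := mul_dvd_mul_left _ h1
      refine dvd_trans ?_ h2
      rw [← pow_add]
      exact pow_dvd_pow _ (by omega)
    -- A_{K+2} − A_{K+1} = −Σ_{j<K+1} X^{j+1}(P(A_{K+1}) − P(A_K)) − X^{K+2} P_{K+2}(A_{K+1})
    have hrw : A N (K + 1 + 1) - A N (K + 1) =
        -(∑ j ∈ Finset.range (K + 1), Polynomial.X ^ (j + 1) * ((Pz N (j + 1)).comp (A N (K + 1)) - (Pz N (j + 1)).comp (A N K)))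
          - Polynomial.X ^ (K + 1 + 1) * (Pz N (K + 1 + 1)).comp (A N (K + 1)) := by
      show (1 - ∑ j ∈ Finset.range (K + 1 + 1), Polynomial.X ^ (j + 1) * (Pz N (j + 1)).comp (A N (K + 1)))
          - (1 - ∑ j ∈ Finset.range (K + 1), Polynomial.X ^ (j + 1) * (Pz N (j + 1)).comp (A N K)) = _
      rw [Finset.sum_range_succ, Finset.sum_congr rfl fun j _ => mul_sub (Polynomial.X ^ (j + 1)) _ _, Finset.sum_sub_distrib]
      ring
    rw [hrw]
    refine dvd_sub (Dvd.dvd.neg_right (Finset.dvd_sum fun j _ => hstep j)) (dvd_mul_right _ _)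

/-- THE coefficients of the `u`-expansion: `a_k := [X^k] A_k`. [folklore] -/
def a (k : ℕ) : ℤ := (A N k).coeff k

/-- Stability: `[X^k] A_K = a_k` for `k ≤ K` (`X^{K+1} ∣ A_{K+1} − A_K`). [cite: JansevanRensburgWhittington2013, §3.2 Theorem 8 (arXiv v4 p. 11)] -/
theorem coeff_A_eq_a {k K : ℕ} (hk : k ≤ K) : (A N K).coeff k = a N k := by
  induction K with
  | zero => obtain rfl : k = 0 := Nat.le_zero.1 hk; rfl
  | succ K ih =>
    rcases Nat.lt_or_ge k (K + 1) with h | h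
    · have hd := (Polynomial.X_pow_dvd_iff.1 (X_pow_dvd_A_succ_sub N K)) k h
      rw [Polynomial.coeff_sub, sub_eq_zero] at hd
      rw [hd, ih (by omega)]
    · obtain rfl : k = K + 1 := le_antisymm hk h; rfl

/-! ### The junk tail and the convergent `u`-expansion -/

/-- The high part of `A_K` is small: `|A_K(t) − Σ_{k ≤ K} a_k t^k| ≤ 4 · 2^{−K−1}` for `0 ≤ t ≤ T₀/2`. [folklore] -/
private theorem abs_ev_A_sub_sum_le {B ρ : ℝ} (hB : 0 ≤ B) (hρ : 0 < ρ)
    (hN : ∀ c, (∑ n ∈ Finset.range (2 * c + 2), (N c n : ℝ)) ≤ B * ρ ^ c) {t : ℝ} (ht0 : 0 ≤ t)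
    (ht : t ≤ 1 / (32 * ρ * (B + 1))) (K : ℕ) :
    |ev (A N K) t - ∑ k ∈ Finset.range (K + 1), (a N k : ℝ) * t ^ k| ≤ 4 * (1 / 2) ^ (K + 1) := by
  have hR0 : 0 < 16 * ρ * (B + 1) := by positivity
  have hRt : 16 * ρ * (B + 1) * t ≤ 1 / 2 := by
    have := mul_le_mul_of_nonneg_left ht hR0.le
    rwa [show 16 * ρ * (B + 1) * (1 / (32 * ρ * (B + 1))) = (1 : ℝ) / 2 by field_simp; ring] at this
  -- write ev (A K) t as a sum over range (M) with M = max (natDegree + 1) (K + 1)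
  set D := (A N K).natDegree with hD
  set M := D + 1 + (K + 1) with hM
  have hev : ev (A N K) t = ∑ k ∈ Finset.range M, ((A N K).coeff k : ℝ) * t ^ k := by
    rw [ev, Polynomial.aeval_eq_sum_range' (show (A N K).natDegree < M by omega)]
    simp [zsmul_eq_mul]
  have hlow : ∑ k ∈ Finset.range (K + 1), (a N k : ℝ) * t ^ k = ∑ k ∈ Finset.range (K + 1), ((A N K).coeff k : ℝ) * t ^ k :=
    Finset.sum_congr rfl fun k hk => by rw [coeff_A_eq_a N (Nat.lt_succ_iff.1 (Finset.mem_range.1 hk))]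
  rw [hev, hlow, show M = (K + 1) + (D + 1) by omega, Finset.sum_range_add, add_sub_cancel_left]
  calc |∑ x ∈ Finset.range (D + 1), ((A N K).coeff (K + 1 + x) : ℝ) * t ^ (K + 1 + x)|
      ≤ ∑ x ∈ Finset.range (D + 1), |((A N K).coeff (K + 1 + x) : ℝ) * t ^ (K + 1 + x)| := Finset.abs_sum_le_sum_abs _ _
    _ ≤ ∑ x ∈ Finset.range (D + 1), 2 * (1 / 2) ^ (K + 1) * (1 / 2) ^ x := by
        refine Finset.sum_le_sum fun x _ => ?_
        rw [abs_mul, abs_pow, abs_of_nonneg ht0]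
        have h1 := abs_coeff_A_le N hB hρ hN K (K + 1 + x)
        calc |((A N K).coeff (K + 1 + x) : ℝ)| * t ^ (K + 1 + x) ≤ 2 * (16 * ρ * (B + 1)) ^ (K + 1 + x) * t ^ (K + 1 + x) :=
              mul_le_mul_of_nonneg_right h1 (by positivity)
          _ = 2 * (16 * ρ * (B + 1) * t) ^ (K + 1 + x) := by rw [mul_pow (16 * ρ * (B + 1)) t]; ring
          _ ≤ 2 * (1 / 2) ^ (K + 1 + x) := by
              refine mul_le_mul_of_nonneg_left (pow_le_pow_left₀ (by positivity) hRt _) (by norm_num)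
          _ = 2 * (1 / 2) ^ (K + 1) * (1 / 2) ^ x := by rw [pow_add]; ring
    _ = 2 * (1 / 2) ^ (K + 1) * ∑ x ∈ Finset.range (D + 1), (1 / 2 : ℝ) ^ x := by rw [Finset.mul_sum]
    _ ≤ 2 * (1 / 2) ^ (K + 1) * 2 :=
        mul_le_mul_of_nonneg_left (geom_sum_le_two (by norm_num) le_rfl (D + 1)) (by positivity)
    _ = 4 * (1 / 2) ^ (K + 1) := by ring

/-- ★★ **The `u`-expansion CONVERGES**: under the hypotheses of `expansion`, for `0 < t ≤ t** = min t₀ (1/(400ρ(B+1)))`,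
`Σ_k a_k t^k = u(t)` (`HasSum`). [cite: JansevanRensburgWhittington2013, §3.2 Theorem 8 (arXiv v4 p. 11)] -/
theorem hasSum_a {B ρ t₀ : ℝ} {u : ℝ → ℝ} (hB : 0 ≤ B) (hρ : 0 < ρ)
    (hN : ∀ c, (∑ n ∈ Finset.range (2 * c + 2), (N c n : ℝ)) ≤ B * ρ ^ c) (hP0 : ∀ x, P N 0 x = x)
    (hmem : ∀ t ∈ Set.Ioc 0 t₀, u t ∈ Set.Icc (0 : ℝ) 1)
    (heq : ∀ t ∈ Set.Ioc 0 t₀, HasSum (fun c => t ^ c * P N c (u t)) 1)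
    {t : ℝ} (ht : t ∈ Set.Ioc 0 (min t₀ (1 / (400 * ρ * (B + 1))))) :
    HasSum (fun k => (a N k : ℝ) * t ^ k) (u t) := by
  have ht0 : 0 < t := ht.1
  have ht400 : t ≤ 1 / (400 * ρ * (B + 1)) := ht.2.trans (min_le_right _ _)
  have ht32 : t ≤ 1 / (32 * ρ * (B + 1)) :=
    ht400.trans (div_le_div_of_nonneg_left (by norm_num) (by positivity) (by nlinarith [hρ, hB]))
  have hR0 : 0 < 16 * ρ * (B + 1) := by positivity
  have hRt : 16 * ρ * (B + 1) * t ≤ 1 / 2 := by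
    have := mul_le_mul_of_nonneg_left ht32 hR0.le
    rwa [show 16 * ρ * (B + 1) * (1 / (32 * ρ * (B + 1))) = (1 : ℝ) / 2 by field_simp; ring] at this
  -- summability by geometric domination
  have hsum : Summable fun k => (a N k : ℝ) * t ^ k := by
    refine Summable.of_norm_bounded (g := fun k => 2 * (1 / 2 : ℝ) ^ k) ((summable_geometric_of_lt_one (by norm_num)
      (by norm_num)).mul_left 2) fun k => ?_
    rw [Real.norm_eq_abs, abs_mul, abs_pow, abs_of_pos ht0]
    have h1 := abs_coeff_A_le N hB hρ hN k k
    rw [coeff_A_eq_a N le_rfl] at h1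
    calc |(a N k : ℝ)| * t ^ k ≤ 2 * (16 * ρ * (B + 1)) ^ k * t ^ k := mul_le_mul_of_nonneg_right h1 (by positivity)
      _ = 2 * (16 * ρ * (B + 1) * t) ^ k := by rw [mul_pow (16 * ρ * (B + 1)) t]; ring
      _ ≤ 2 * (1 / 2) ^ k := mul_le_mul_of_nonneg_left (pow_le_pow_left₀ (by positivity) hRt _) (by norm_num)
  rw [hsum.hasSum_iff_tendsto_nat]
  -- partial sums: Σ_{k<n} a_k t^k = A_{n-1}(t) − junk, within 2^{-(n-1)} + 4·2^{-n} of u t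
  have hbound : ∀ n : ℕ, 1 ≤ n → dist (∑ k ∈ Finset.range n, (a N k : ℝ) * t ^ k) (u t) ≤ 6 * (1 / 2) ^ n := by
    intro n hn
    obtain ⟨K, rfl⟩ : ∃ K, n = K + 1 := ⟨n - 1, by omega⟩
    have h1 := abs_sub_ev_A_le_half_pow N hB hρ hN hP0 hmem heq ht K
    have h2 := abs_ev_A_sub_sum_le N hB hρ hN ht0.le ht32 K
    rw [Real.dist_eq]
    calc |∑ k ∈ Finset.range (K + 1), (a N k : ℝ) * t ^ k - u t|
        = |(u t - ev (A N K) t) + (ev (A N K) t - ∑ k ∈ Finset.range (K + 1), (a N k : ℝ) * t ^ k)| := by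
          rw [abs_sub_comm]; congr 1; ring
      _ ≤ |u t - ev (A N K) t| + |ev (A N K) t - ∑ k ∈ Finset.range (K + 1), (a N k : ℝ) * t ^ k| := abs_add_le _ _
      _ ≤ (1 / 2) ^ K + 4 * (1 / 2) ^ (K + 1) := add_le_add h1 h2
      _ = 6 * (1 / 2) ^ (K + 1) := by rw [pow_succ]; ring
  refine Metric.tendsto_atTop.2 fun ε hε => ?_
  obtain ⟨n₀, hn₀⟩ := exists_pow_lt_of_lt_one (show 0 < ε / 6 by positivity) (show (1 / 2 : ℝ) < 1 by norm_num)
  refine ⟨n₀ + 1, fun n hn => ?_⟩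
  have h1 := hbound n (by omega)
  have h2 : (1 / 2 : ℝ) ^ n ≤ (1 / 2) ^ n₀ := pow_le_pow_of_le_one (by norm_num) (by norm_num) (by omega)
  linarith

/-! ### The inverse polynomials `E_K = Σ_{j ≤ K} (1 − A_K)^j` and their majorants -/

/-- `E_K := Σ_{j ≤ K} (1 − A_K)^j` (generic form of `Zd.largeForcePoly`). [folklore] -/
def E (K : ℕ) : Polynomial ℤ := ∑ j ∈ Finset.range (K + 1), (1 - A N K) ^ j

/-- The majorant `Ê_K := Σ_{j ≤ K} (1 + Â_K)^j`. [folklore] -/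
def Ehat (K : ℕ) : Polynomial ℕ := ∑ j ∈ Finset.range (K + 1), (1 + Ahat N K) ^ j

/-- `E_K` is dominated by `Ê_K`. [folklore] -/
private theorem dom_E_Ehat (K : ℕ) : Dom (E N K) (Ehat N K) :=
  Dom.sum _ fun j _ => (Dom.one.sub (dom_A_Ahat N K)).pow j

/-- Evaluation of `E_K`. [folklore] -/
private theorem ev_E (K : ℕ) (t : ℝ) : ev (E N K) t = ∑ j ∈ Finset.range (K + 1), (1 - ev (A N K) t) ^ j := by
  simp [ev, E, map_sum]

/-- `Ê_K(T₀) ≤ 3^{K+1}` at the supersolution point. [folklore] -/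
private theorem evN_Ehat_le {B ρ : ℝ} (hB : 0 ≤ B) (hρ : 0 < ρ)
    (hN : ∀ c, (∑ n ∈ Finset.range (2 * c + 2), (N c n : ℝ)) ≤ B * ρ ^ c) (K : ℕ) :
    evN (Ehat N K) (1 / (16 * ρ * (B + 1))) ≤ 3 ^ (K + 1) := by
  have hA := evN_Ahat_le_two N hB hρ hN K
  have h0 : 0 ≤ evN (Ahat N K) (1 / (16 * ρ * (B + 1))) := evN_nonneg (Ahat N K) (by positivity)
  have hev : evN (Ehat N K) (1 / (16 * ρ * (B + 1))) =
      ∑ j ∈ Finset.range (K + 1), (1 + evN (Ahat N K) (1 / (16 * ρ * (B + 1)))) ^ j := by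
    simp [evN, Ehat, Polynomial.map_sum, Polynomial.eval_finsetSum]
  rw [hev]
  have hgeom : ∀ n : ℕ, ∑ j ∈ Finset.range n, (3 : ℝ) ^ j ≤ 3 ^ n := by
    intro n
    induction n with
    | zero => simp
    | succ n ih => rw [Finset.sum_range_succ, pow_succ]; nlinarith [pow_pos (show (0:ℝ) < 3 by norm_num) n]
  calc ∑ j ∈ Finset.range (K + 1), (1 + evN (Ahat N K) (1 / (16 * ρ * (B + 1)))) ^ j
      ≤ ∑ j ∈ Finset.range (K + 1), (3 : ℝ) ^ j :=
        Finset.sum_le_sum fun j _ => pow_le_pow_left₀ (by positivity) (by linarith) j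
    _ ≤ 3 ^ (K + 1) := hgeom (K + 1)

/-- Geometric bound on the coefficients of `E_K`: `|[X^k] E_K| ≤ 3^{K+1} (16ρ(B+1))^k`. [cite: JansevanRensburgWhittington2013, §3.2 Theorem 8 (arXiv v4 p. 11)] -/
theorem abs_coeff_E_le {B ρ : ℝ} (hB : 0 ≤ B) (hρ : 0 < ρ)
    (hN : ∀ c, (∑ n ∈ Finset.range (2 * c + 2), (N c n : ℝ)) ≤ B * ρ ^ c) (K k : ℕ) :
    |((E N K).coeff k : ℝ)| ≤ 3 ^ (K + 1) * (16 * ρ * (B + 1)) ^ k := by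
  have hR : 0 < 16 * ρ * (B + 1) := by positivity
  set T : ℝ := 1 / (16 * ρ * (B + 1)) with hT
  have hT0 : 0 < T := by rw [hT]; positivity
  have h1 : |((E N K).coeff k : ℝ)| ≤ ((Ehat N K).coeff k : ℝ) := by exact_mod_cast dom_E_Ehat N K k
  have h2 : ((Ehat N K).coeff k : ℝ) * T ^ k ≤ 3 ^ (K + 1) :=
    (coeff_mul_pow_le_evN (Ehat N K) hT0.le k).trans (evN_Ehat_le N hB hρ hN K)
  have hTk : T ^ k * (16 * ρ * (B + 1)) ^ k = 1 := by
    rw [← mul_pow, hT, one_div, inv_mul_cancel₀ hR.ne', one_pow]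
  have h3 : ((Ehat N K).coeff k : ℝ) ≤ 3 ^ (K + 1) * (16 * ρ * (B + 1)) ^ k := by
    have := mul_le_mul_of_nonneg_right h2 (pow_nonneg hR.le k)
    rwa [mul_assoc, hTk, mul_one] at this
  exact h1.trans h3

/-- The high part of `E_K` is small: `|E_K(t) − Σ_{k ≤ K} [X^k]E_K t^k| ≤ 2 · (1/2)^{K+1}` for `0 ≤ t ≤ T₀/6`. [folklore] -/
private theorem abs_ev_E_sub_sum_le {B ρ : ℝ} (hB : 0 ≤ B) (hρ : 0 < ρ)
    (hN : ∀ c, (∑ n ∈ Finset.range (2 * c + 2), (N c n : ℝ)) ≤ B * ρ ^ c) {t : ℝ} (ht0 : 0 ≤ t)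
    (ht : t ≤ 1 / (96 * ρ * (B + 1))) (K : ℕ) :
    |ev (E N K) t - ∑ k ∈ Finset.range (K + 1), ((E N K).coeff k : ℝ) * t ^ k| ≤ 2 * (1 / 2) ^ (K + 1) := by
  have hR0 : 0 < 16 * ρ * (B + 1) := by positivity
  have hRt : 16 * ρ * (B + 1) * t ≤ 1 / 6 := by
    have := mul_le_mul_of_nonneg_left ht hR0.le
    rwa [show 16 * ρ * (B + 1) * (1 / (96 * ρ * (B + 1))) = (1 : ℝ) / 6 by field_simp; ring] at this
  have h3q : 3 * (16 * ρ * (B + 1) * t) ≤ 1 / 2 := by linarith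
  set D := (E N K).natDegree with hD
  set M := D + 1 + (K + 1) with hM
  have hev : ev (E N K) t = ∑ k ∈ Finset.range M, ((E N K).coeff k : ℝ) * t ^ k := by
    rw [ev, Polynomial.aeval_eq_sum_range' (show (E N K).natDegree < M by omega)]
    simp [zsmul_eq_mul]
  rw [hev, show M = (K + 1) + (D + 1) by omega, Finset.sum_range_add, add_sub_cancel_left]
  calc |∑ x ∈ Finset.range (D + 1), ((E N K).coeff (K + 1 + x) : ℝ) * t ^ (K + 1 + x)|
      ≤ ∑ x ∈ Finset.range (D + 1), |((E N K).coeff (K + 1 + x) : ℝ) * t ^ (K + 1 + x)| := Finset.abs_sum_le_sum_abs _ _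
    _ ≤ ∑ x ∈ Finset.range (D + 1), (1 / 2) ^ (K + 1) * (1 / 2) ^ x := by
        refine Finset.sum_le_sum fun x _ => ?_
        rw [abs_mul, abs_pow, abs_of_nonneg ht0]
        have h1 := abs_coeff_E_le N hB hρ hN K (K + 1 + x)
        calc |((E N K).coeff (K + 1 + x) : ℝ)| * t ^ (K + 1 + x)
            ≤ 3 ^ (K + 1) * (16 * ρ * (B + 1)) ^ (K + 1 + x) * t ^ (K + 1 + x) := mul_le_mul_of_nonneg_right h1 (by positivity)
          _ = (3 * (16 * ρ * (B + 1) * t)) ^ (K + 1) * (16 * ρ * (B + 1) * t) ^ x := by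
              rw [mul_pow 3, mul_pow (16 * ρ * (B + 1)) t, mul_pow (16 * ρ * (B + 1)) t, pow_add, pow_add]; ring
          _ ≤ (1 / 2) ^ (K + 1) * (1 / 2) ^ x := by
              refine mul_le_mul (pow_le_pow_left₀ (by positivity) h3q _)
                (pow_le_pow_left₀ (by positivity) (by linarith) _) (by positivity) (by positivity)
    _ = (1 / 2) ^ (K + 1) * ∑ x ∈ Finset.range (D + 1), (1 / 2 : ℝ) ^ x := by rw [Finset.mul_sum]
    _ ≤ (1 / 2) ^ (K + 1) * 2 := mul_le_mul_of_nonneg_left (geom_sum_le_two (by norm_num) le_rfl (D + 1)) (by positivity)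
    _ = 2 * (1 / 2) ^ (K + 1) := by ring

end CostSeries

/-! ### The pulled walk: the expansion of `u(y)` and of `e^{λ_B(y)}` CONVERGES -/

/-- The cost data of the pulled walk satisfy the hypotheses with `B = 2κ`, `ρ = 2κ²`, `t₀ = 1/18`: the window hypothesis.
[cite: JansevanRensburgWhittington2013, §3.2 Theorem 8 (arXiv v4 p. 11)] -/
private theorem mem_Icc_largeForceU_inv : ∀ t ∈ Set.Ioc (0 : ℝ) (1 / 18), largeForceU t⁻¹ ∈ Set.Icc (0 : ℝ) 1 := by
  intro t ht
  have hy : 18 ≤ t⁻¹ := by rw [le_inv_comm₀ (by norm_num) ht.1]; simpa [one_div] using ht.2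
  exact ⟨(largeForceU_pos (by linarith)).le, (largeForceU_lt_one (by linarith)).le⟩

/-- The radius (in `t = 1/y`) inside which everything below holds: `t* = min (1/18) (1/(400ρ(B+1)))`, `B = 2κ`, `ρ = 2κ²`.
[cite: JansevanRensburgWhittington2013, §3.2 Theorem 8 (arXiv v4 p. 11)] -/
def tStar : ℝ := min (1 / 18) (1 / (400 * (2 * kappa ^ 2) * (2 * kappa + 1)))

/-- `κ > 0`. [folklore] -/
private theorem kappa_pos : 0 < kappa := by
  have : (1 : ℝ) ≤ kappa := by unfold kappa; exact_mod_cast one_le_count 2 1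
  linarith

/-- `t* > 0`. [cite: JansevanRensburgWhittington2013, §3.2 Theorem 8 (arXiv v4 p. 11)] -/
theorem tStar_pos : 0 < tStar := by
  have := kappa_pos
  unfold tStar; exact lt_min (by norm_num) (by positivity)

/-- ★ **Uniform contraction for the pulled walk**: `|u(1/t) − A_K(t)| ≤ 2^{−K}` for `0 < t ≤ t*` and every `K`.
[cite: JansevanRensburgWhittington2013, §3.2 Theorem 8 (arXiv v4 p. 11)] -/
theorem abs_largeForceU_sub_ev_A_le {t : ℝ} (ht : t ∈ Set.Ioc 0 tStar) (K : ℕ) :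
    |largeForceU t⁻¹ - CostSeries.ev (CostSeries.A costCoeff K) t| ≤ (1 / 2) ^ K :=
  CostSeries.abs_sub_ev_A_le_half_pow costCoeff (B := 2 * kappa) (ρ := 2 * kappa ^ 2) (t₀ := 1 / 18)
    (u := fun t => largeForceU t⁻¹) (by have := kappa_pos; positivity) (by have := kappa_pos; positivity)
    sum_costCoeff_le P_costCoeff_zero mem_Icc_largeForceU_inv (fun t ht => hasSum_costPoly_inv ht.1 ht.2) ht K

/-- ★★ **The `u`-expansion converges**: `Σ_k a_k t^k = u(1/t)` for `0 < t ≤ t*`, `a_k = [X^k] A_k ∈ ℤ`.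
[cite: JansevanRensburgWhittington2013, §3.2 Theorem 8 (arXiv v4 p. 11)] -/
theorem hasSum_largeForceU {t : ℝ} (ht : t ∈ Set.Ioc 0 tStar) :
    HasSum (fun k => (CostSeries.a costCoeff k : ℝ) * t ^ k) (largeForceU t⁻¹) :=
  CostSeries.hasSum_a costCoeff (B := 2 * kappa) (ρ := 2 * kappa ^ 2) (t₀ := 1 / 18)
    (u := fun t => largeForceU t⁻¹) (by have := kappa_pos; positivity) (by have := kappa_pos; positivity)
    sum_costCoeff_le P_costCoeff_zero mem_Icc_largeForceU_inv (fun t ht => hasSum_costPoly_inv ht.1 ht.2) ht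

/-- `largeForcePoly` is the generic `E`. [folklore] -/
private theorem largeForcePoly_eq_E (K : ℕ) : largeForcePoly K = CostSeries.E costCoeff K := rfl

/-- ★★★ **The expansion of `1/u(y) = e^{λ_B(y)}/y` converges**: `Σ_k c_k t^k = 1/u(1/t)` for `0 < t ≤ t*`.
[cite: JansevanRensburgWhittington2013, §3.2 Theorem 8 (arXiv v4 p. 11)] [cite: Beaton2015, Lemma 2] -/
theorem hasSum_largeForceCoeff_inv {t : ℝ} (ht : t ∈ Set.Ioc 0 tStar) :
    HasSum (fun k => (largeForceCoeff k : ℝ) * t ^ k) (largeForceU t⁻¹)⁻¹ := by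
  have hκ := kappa_pos
  set B : ℝ := 2 * kappa with hBdef
  set ρ : ℝ := 2 * kappa ^ 2 with hρdef
  have hB : 0 ≤ B := by positivity
  have hρ : 0 < ρ := by positivity
  have hN : ∀ c, (∑ n ∈ Finset.range (2 * c + 2), (costCoeff c n : ℝ)) ≤ B * ρ ^ c := sum_costCoeff_le
  have ht0 : 0 < t := ht.1
  have ht18 : t ≤ 1 / 18 := ht.2.trans (min_le_left _ _)
  have ht400 : t ≤ 1 / (400 * ρ * (B + 1)) := ht.2.trans (min_le_right _ _)
  have ht96 : t ≤ 1 / (96 * ρ * (B + 1)) :=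
    ht400.trans (div_le_div_of_nonneg_left (by norm_num) (by positivity) (by nlinarith [hρ, hB]))
  have hy9 : 9 ≤ t⁻¹ := by
    have : 18 ≤ t⁻¹ := by rw [le_inv_comm₀ (by norm_num) ht0]; simpa [one_div] using ht18
    linarith
  set u := largeForceU t⁻¹ with hu
  have hu2 : 1 / 2 ≤ u := half_le_largeForceU hy9
  have hu1 : u ≤ 1 := (largeForceU_lt_one hy9).le
  have h1u : 1 - u ≤ 3 * t := by
    have := one_sub_largeForceU_le hy9
    rwa [div_inv_eq_mul] at this
  have hR0 : 0 < 16 * ρ * (B + 1) := by positivity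
  have hRt : 3 * (16 * ρ * (B + 1) * t) ≤ 1 / 2 := by
    have := mul_le_mul_of_nonneg_left ht96 hR0.le
    rw [show 16 * ρ * (B + 1) * (1 / (96 * ρ * (B + 1))) = (1 : ℝ) / 6 by field_simp; ring] at this
    linarith
  -- summability of c_k t^k by the geometric bound on [X^k]E_k
  have hsum : Summable fun k => (largeForceCoeff k : ℝ) * t ^ k := by
    refine Summable.of_norm_bounded (g := fun k => 3 * (1 / 2 : ℝ) ^ k) ((summable_geometric_of_lt_one (by norm_num)
      (by norm_num)).mul_left 3) fun k => ?_
    rw [Real.norm_eq_abs, abs_mul, abs_pow, abs_of_pos ht0]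
    have h1 := CostSeries.abs_coeff_E_le costCoeff hB hρ hN k k
    have hc : ((largeForceCoeff k : ℤ) : ℝ) = ((CostSeries.E costCoeff k).coeff k : ℝ) := by
      rw [largeForceCoeff, largeForcePoly_eq_E]
    rw [hc]
    calc |((CostSeries.E costCoeff k).coeff k : ℝ)| * t ^ k ≤ 3 ^ (k + 1) * (16 * ρ * (B + 1)) ^ k * t ^ k :=
          mul_le_mul_of_nonneg_right h1 (by positivity)
      _ = 3 * (3 * (16 * ρ * (B + 1) * t)) ^ k := by rw [pow_succ, mul_pow 3, mul_pow (16 * ρ * (B + 1)) t]; ring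
      _ ≤ 3 * (1 / 2) ^ k := mul_le_mul_of_nonneg_left (pow_le_pow_left₀ (by positivity) hRt _) (by norm_num)
  rw [hsum.hasSum_iff_tendsto_nat]
  -- distance bound for the partial sums of length K + 1 with K ≥ 2
  have hbound : ∀ K : ℕ, 2 ≤ K → dist (∑ k ∈ Finset.range (K + 1), (largeForceCoeff k : ℝ) * t ^ k) u⁻¹ ≤ 11 * (1 / 2) ^ K := by
    intro K hK
    set a := CostSeries.ev (CostSeries.A costCoeff K) t with ha
    have hK1 := abs_largeForceU_sub_ev_A_le ht K
    rw [← hu, ← ha] at hK1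
    have hhalf : (1 / 2 : ℝ) ^ K ≤ 1 / 4 := by
      calc (1 / 2 : ℝ) ^ K ≤ (1 / 2) ^ 2 := pow_le_pow_of_le_one (by norm_num) (by norm_num) hK
        _ = 1 / 4 := by norm_num
    have hua : |u - a| ≤ 1 / 4 := hK1.trans hhalf
    have ha4 : 1 / 4 ≤ a := by have := abs_le.1 hua; linarith
    have ha0 : 0 < a := by linarith
    have hu0 : 0 < u := by linarith
    -- (1) |1/u − 1/a| ≤ 8 · 2^{-K}
    have h1 : |u⁻¹ - a⁻¹| ≤ 8 * (1 / 2) ^ K := by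
      rw [inv_sub_inv hu0.ne' ha0.ne', abs_div, abs_mul, abs_of_pos hu0, abs_of_pos ha0, abs_sub_comm, div_le_iff₀ (mul_pos hu0 ha0)]
      calc |u - a| ≤ (1 / 2) ^ K := hK1
        _ = 8 * (1 / 2) ^ K * (1 / 2 * (1 / 4)) := by ring
        _ ≤ 8 * (1 / 2) ^ K * (u * a) :=
            mul_le_mul_of_nonneg_left (mul_le_mul hu2 ha4 (by norm_num) hu0.le) (by positivity)
    -- (2) |1/a − E_K(t)| ≤ 4 · (1/2)^{K+1}
    have hE : CostSeries.ev (CostSeries.E costCoeff K) t = ∑ j ∈ Finset.range (K + 1), (1 - a) ^ j := CostSeries.ev_E costCoeff K t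
    have hgeom : a * ∑ j ∈ Finset.range (K + 1), (1 - a) ^ j = 1 - (1 - a) ^ (K + 1) := by
      have := mul_neg_geom_sum (1 - a) (K + 1)
      rwa [sub_sub_cancel] at this
    have h1a : |1 - a| ≤ 1 / 2 := by
      calc |1 - a| = |(1 - u) + (u - a)| := by ring_nf
        _ ≤ |1 - u| + |u - a| := abs_add_le _ _
        _ ≤ 3 * t + 1 / 4 := by
            refine add_le_add ?_ hua
            rw [abs_of_nonneg (by linarith)]; exact h1u
        _ ≤ 1 / 2 := by linarith
    have h2 : |a⁻¹ - CostSeries.ev (CostSeries.E costCoeff K) t| ≤ 4 * (1 / 2) ^ (K + 1) := by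
      have heq : a⁻¹ - CostSeries.ev (CostSeries.E costCoeff K) t = (1 - a) ^ (K + 1) / a := by
        rw [hE, eq_div_iff ha0.ne', sub_mul, inv_mul_cancel₀ ha0.ne', mul_comm, hgeom]; ring
      rw [heq, abs_div, abs_of_pos ha0, abs_pow, div_le_iff₀ ha0]
      calc |1 - a| ^ (K + 1) ≤ (1 / 2) ^ (K + 1) := pow_le_pow_left₀ (abs_nonneg _) h1a _
        _ = 4 * (1 / 2) ^ (K + 1) * (1 / 4) := by ring
        _ ≤ 4 * (1 / 2) ^ (K + 1) * a := mul_le_mul_of_nonneg_left ha4 (by positivity)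
    -- (3) junk tail of E_K, and stability [X^k]E_K = c_k (k ≤ K)
    have h3 := CostSeries.abs_ev_E_sub_sum_le costCoeff hB hρ hN ht0.le ht96 K
    have hstab : ∑ k ∈ Finset.range (K + 1), ((CostSeries.E costCoeff K).coeff k : ℝ) * t ^ k =
        ∑ k ∈ Finset.range (K + 1), (largeForceCoeff k : ℝ) * t ^ k := by
      refine Finset.sum_congr rfl fun k hk => ?_
      rw [← largeForcePoly_eq_E, largeForcePoly_coeff (Nat.lt_succ_iff.1 (Finset.mem_range.1 hk))]
    rw [hstab] at h3
    rw [Real.dist_eq, abs_sub_comm]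
    calc |u⁻¹ - ∑ k ∈ Finset.range (K + 1), (largeForceCoeff k : ℝ) * t ^ k|
        = |(u⁻¹ - a⁻¹) + (a⁻¹ - CostSeries.ev (CostSeries.E costCoeff K) t)
            + (CostSeries.ev (CostSeries.E costCoeff K) t - ∑ k ∈ Finset.range (K + 1), (largeForceCoeff k : ℝ) * t ^ k)| := by
          congr 1; ring
      _ ≤ |u⁻¹ - a⁻¹| + |a⁻¹ - CostSeries.ev (CostSeries.E costCoeff K) t|
            + |CostSeries.ev (CostSeries.E costCoeff K) t - ∑ k ∈ Finset.range (K + 1), (largeForceCoeff k : ℝ) * t ^ k| :=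
          (abs_add_le _ _).trans (add_le_add (abs_add_le _ _) le_rfl)
      _ ≤ 8 * (1 / 2) ^ K + 4 * (1 / 2) ^ (K + 1) + 2 * (1 / 2) ^ (K + 1) := add_le_add (add_le_add h1 h2) h3
      _ = 11 * (1 / 2) ^ K := by rw [pow_succ]; ring
  refine Metric.tendsto_atTop.2 fun ε hε => ?_
  obtain ⟨n₀, hn₀⟩ := exists_pow_lt_of_lt_one (show 0 < ε / 11 by positivity) (show (1 / 2 : ℝ) < 1 by norm_num)
  refine ⟨n₀ + 3, fun n hn => ?_⟩
  obtain ⟨K, rfl⟩ : ∃ K, n = K + 1 := ⟨n - 1, by omega⟩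
  have h1 := hbound K (by omega)
  have h2 : (1 / 2 : ℝ) ^ K ≤ (1 / 2) ^ n₀ := pow_le_pow_of_le_one (by norm_num) (by norm_num) (by omega)
  rw [hu] at h1
  linarith

/-- ★★★★ **THE LARGE-FORCE EXPANSION CONVERGES**: for every `y ≥ 1/t*`,
`e^{λ_B(y)} = Σ_{k=0}^{∞} c_k · y^{1−k}` (`HasSum`), with THE integer coefficients `c_k = largeForceCoeff k`
(`c_0, c_1, … = 1, 2, −2, 6, −20, 74, …`): the pulled free energy is a real-analytic function of `1/y` at `y = ∞` in the sense
that its expansion in powers of `1/y` has positive radius of convergence and sums to it.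
[cite: JansevanRensburgWhittington2013, §3.2 Theorem 8 (arXiv v4 p. 11)] [cite: Beaton2015, Lemma 2] -/
theorem hasSum_largeForceCoeff {y : ℝ} (hy : tStar⁻¹ ≤ y) :
    HasSum (fun k => y * ((largeForceCoeff k : ℝ) * y⁻¹ ^ k)) (Real.exp (pulledBridgeFreeEnergy 2 y)) := by
  have hy0 : 0 < y := lt_of_lt_of_le (inv_pos.2 tStar_pos) hy
  have ht : y⁻¹ ∈ Set.Ioc 0 tStar := ⟨inv_pos.2 hy0, by rwa [inv_le_comm₀ hy0 tStar_pos]⟩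
  have h := (hasSum_largeForceCoeff_inv ht).mul_left y
  rw [inv_inv] at h
  rwa [exp_pulledBridgeFreeEnergy_eq_div hy0, div_eq_mul_inv]

/-- The same in `∃`-form with `tsum`: `∃ y₀, ∀ y ≥ y₀, e^{λ_B(y)} = Σ' k, c_k y^{1−k}` and the series is summable.
[cite: JansevanRensburgWhittington2013, §3.2 Theorem 8 (arXiv v4 p. 11)] -/
theorem exp_pulledBridgeFreeEnergy_eq_tsum :
    ∃ y₀ : ℝ, 0 < y₀ ∧ ∀ y ≥ y₀, (Summable fun k => y * ((largeForceCoeff k : ℝ) * y⁻¹ ^ k)) ∧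
      Real.exp (pulledBridgeFreeEnergy 2 y) = ∑' k, y * ((largeForceCoeff k : ℝ) * y⁻¹ ^ k) :=
  ⟨tStar⁻¹, inv_pos.2 tStar_pos, fun _ hy => ⟨(hasSum_largeForceCoeff hy).summable, (hasSum_largeForceCoeff hy).tsum_eq.symm⟩⟩

/-! ### Analytic form: `t · e^{λ_B(1/t)}` extends to a real-analytic function at `t = 0` -/

/-- The generating power series of THE coefficients, `g(t) := Σ_k c_k t^k`, as a formal multilinear series on `ℝ`.
[cite: JansevanRensburgWhittington2013, §3.2 Theorem 8 (arXiv v4 p. 11)] -/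
def largeForceSeries : FormalMultilinearSeries ℝ ℝ ℝ :=
  FormalMultilinearSeries.ofScalars ℝ (fun k => (largeForceCoeff k : ℝ))

/-- The formal series has radius `≥ 1/(96ρ(B+1))` (geometric coefficient bound). [cite: JansevanRensburgWhittington2013, §3.2 Theorem 8 (arXiv v4 p. 11)] -/
theorem largeForceSeries_radius_pos : 0 < largeForceSeries.radius := by
  have hκ := kappa_pos
  set B : ℝ := 2 * kappa with hBdef
  set ρ : ℝ := 2 * kappa ^ 2 with hρdef
  have hB : 0 ≤ B := by positivity
  have hρ : 0 < ρ := by positivity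
  have hN : ∀ c, (∑ n ∈ Finset.range (2 * c + 2), (costCoeff c n : ℝ)) ≤ B * ρ ^ c := sum_costCoeff_le
  have hR0 : 0 < 16 * ρ * (B + 1) := by positivity
  have hpos : (0 : ℝ) < 1 / (96 * ρ * (B + 1)) := by positivity
  set r : NNReal := (1 / (96 * ρ * (B + 1))).toNNReal with hr
  have hr0' : 0 < r := by rw [hr]; exact Real.toNNReal_pos.2 hpos
  have hr0 : (0 : ENNReal) < r := ENNReal.coe_pos.2 hr0'
  refine lt_of_lt_of_le hr0 (FormalMultilinearSeries.le_radius_of_bound _ 3 fun k => ?_)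
  have hco : (r : ℝ) = 1 / (96 * ρ * (B + 1)) := by rw [hr]; exact Real.coe_toNNReal _ hpos.le
  rw [largeForceSeries, FormalMultilinearSeries.ofScalars_norm, hco, Real.norm_eq_abs]
  have h1 := CostSeries.abs_coeff_E_le costCoeff hB hρ hN k k
  have hc : ((largeForceCoeff k : ℤ) : ℝ) = ((CostSeries.E costCoeff k).coeff k : ℝ) := by
    rw [largeForceCoeff, largeForcePoly_eq_E]
  rw [hc]
  have hq : 3 * (16 * ρ * (B + 1) * (1 / (96 * ρ * (B + 1)))) = 1 / 2 := by field_simp; ring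
  calc |((CostSeries.E costCoeff k).coeff k : ℝ)| * (1 / (96 * ρ * (B + 1))) ^ k
      ≤ 3 ^ (k + 1) * (16 * ρ * (B + 1)) ^ k * (1 / (96 * ρ * (B + 1))) ^ k := mul_le_mul_of_nonneg_right h1 (by positivity)
    _ = 3 * (3 * (16 * ρ * (B + 1) * (1 / (96 * ρ * (B + 1))))) ^ k := by
        rw [pow_succ, mul_pow 3, mul_pow (16 * ρ * (B + 1))]; ring
    _ = 3 * (1 / 2) ^ k := by rw [hq]
    _ ≤ 3 := by
        have : (1 / 2 : ℝ) ^ k ≤ 1 := pow_le_one₀ (by norm_num) (by norm_num)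
        linarith

/-- ★★★★ **Real-analyticity at `y = ∞`**: the function `g = largeForceSeries.sum` is analytic at `0` (a convergent power series with the
integer coefficients `c_k`), and `g(1/y) = e^{λ_B(y)}/y` for every `y ≥ 1/t*`.
[cite: JansevanRensburgWhittington2013, §3.2 Theorem 8 (arXiv v4 p. 11)] [cite: Beaton2015, Lemma 2] -/
theorem analyticAt_largeForceSeries_sum :
    AnalyticAt ℝ largeForceSeries.sum 0 ∧
      ∀ y ≥ tStar⁻¹, largeForceSeries.sum y⁻¹ = Real.exp (pulledBridgeFreeEnergy 2 y) / y := by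
  refine ⟨(largeForceSeries.hasFPowerSeriesOnBall largeForceSeries_radius_pos).analyticAt, fun y hy => ?_⟩
  have hy0 : 0 < y := lt_of_lt_of_le (inv_pos.2 tStar_pos) hy
  have ht : y⁻¹ ∈ Set.Ioc 0 tStar := ⟨inv_pos.2 hy0, by rwa [inv_le_comm₀ hy0 tStar_pos]⟩
  have h1 : largeForceSeries.sum y⁻¹ = ∑' k, (largeForceCoeff k : ℝ) * y⁻¹ ^ k := by
    rw [largeForceSeries, ← FormalMultilinearSeries.ofScalarsSum, FormalMultilinearSeries.ofScalars_sum_eq]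
    simp [smul_eq_mul]
  rw [h1, (hasSum_largeForceCoeff_inv ht).tsum_eq, inv_inv, exp_pulledBridgeFreeEnergy_eq_div hy0]
  have hu0 : largeForceU y ≠ 0 := (largeForceU_pos hy0).ne'
  field_simp

/-- ★★★★ **`λ_B(y) − log y` is a real-analytic function of `1/y` at `y = ∞`, vanishing there** (Janse van Rensburg–Whittington's
`λ(y) = log y + O(1)` to all orders, convergent): with `g = largeForceSeries.sum`, `log ∘ g` is analytic at `0`, `log (g 0) = 0`, and
`λ_B(y) = log y + log (g (1/y))` for `y ≥ 1/t*`. [cite: JansevanRensburgWhittington2013, §3.2 Theorem 8 (arXiv v4 p. 11)] [cite: Beaton2015, Theorem 1] -/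
theorem analyticAt_pulledBridgeFreeEnergy_sub_log :
    AnalyticAt ℝ (fun t => Real.log (largeForceSeries.sum t)) 0 ∧ Real.log (largeForceSeries.sum 0) = 0 ∧
      ∀ y ≥ tStar⁻¹, pulledBridgeFreeEnergy 2 y = Real.log y + Real.log (largeForceSeries.sum y⁻¹) := by
  obtain ⟨hg, hval⟩ := analyticAt_largeForceSeries_sum
  have hg0 : largeForceSeries.sum 0 = 1 := by
    have h := FormalMultilinearSeries.ofScalarsSum_zero (E := ℝ) (fun k => (largeForceCoeff k : ℝ))
    rw [FormalMultilinearSeries.ofScalarsSum] at h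
    rw [largeForceSeries, h, largeForceCoeff_zero]
    simp
  refine ⟨?_, by rw [hg0, Real.log_one], fun y hy => ?_⟩
  · exact (analyticAt_log (by rw [hg0]; norm_num)).comp hg
  · have hy0 : 0 < y := lt_of_lt_of_le (inv_pos.2 tStar_pos) hy
    rw [hval y hy, Real.log_div (Real.exp_pos _).ne' hy0.ne', Real.log_exp]
    ring

end Literature.Probability.RandomPlanarGeometry.SAW.Zd
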